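import Literature.NumberTheory.Automorphic.RankOneBorel
import Literature.NumberTheory.Automorphic.Luna
import Literature.NumberTheory.Automorphic.BorelParabolic
import HarnessLib

/-!
# The rank-one orbit analysis for an arbitrary Borel subgroup, II: Bruhat decomposition,
# `B = T · U_α`, and Springer 7.3.3 (ii) (trunk T-AUTOMORPHIC, G25 AutomorphicL)

Sequel to `RankOneBorel.lean` (data `RankOneBorelData G T B α u m ρ v`: `B` any Borel subgroup
containing `T`, `U_α = u(𝔾ₐ)` and `Z_G(T)`, `m ∈ N_G(T) ∩ G ∖ B` with `U_α ∩ m B m⁻¹ = {e}`,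
Chevalley's representation `ρ` with `Stab_G [v] = B`, closed orbit cone, `ρ(T)` diagonal). Here:

* the affine slice, its finite fibres and irreducibility, the orbit curve `U_α · [ρ(m) v]` and the
  **Bruhat decomposition** `RankOneBorelData.bruhat`: `G = B ∪ U_α m B` (Springer 7.2.2 (i)), with
  the proofs of `RankOneOrbitBruhat.lean`;
* **existence of the data** (`exists_rankOneBorelData`) for a connected *reductive* `G`, a maximal
  torus `T`, a root `α` with `(Ker α)°` central, a root homomorphism `u` and a Borel subgroup
  `B ⊇ T · U_α`: `Z_G(T) ⊆ B` is 6.4.8 (ii) (`centralizer_le_of_isBorelIn_holds`); a Weyl element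
  `m ∈ N_G(T) ∖ B` exists (`exists_mem_normalizer_not_mem`) since otherwise `B` would be the only
  Borel subgroup containing `T` (6.2.7 (iii), 6.4.1: `exists_mem_normalizer_map_conj_eq_of_isBorelIn`)
  and `U_α` would be trivial by Chevalley's theorem on the unipotent radical in Luna's form
  (`unipotent_eq_bot_of_forall_isBorelIn_le_holds`, Springer 7.6.3); the Borel subgroups containing
  `T` are then `B` and `m B m⁻¹` (`borel_eq_or_eq_map_conj`, 7.1.4 with 6.4.12), and
  `U_α ∩ m B m⁻¹ = {e}` (`eq_zero_of_conj_uval_mem`, 7.2.3 (i)) again by 7.6.3, `U_α ∩ m B m⁻¹`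
  being `T`-stable hence all of `U_α` if non-trivial; the representation is Chevalley's 5.5.3
  (`exists_isAlgebraicGL_lineStabilizer_eq`) with `ρ(T)` diagonalised, its orbit cone closed by
  6.2.7 (ii) (`isClosed_orbitCone_of_borel_le_lineStabilizer_holds`);
* **`B = T · U_α`** (`RankOneBorelData.borel_eq_sup`, the content of Springer 7.2.3 (i)
  `dim U = 1`): by Bruhat, `B ⊆ U_α · (B ∩ m B m⁻¹)`, and `(B ∩ m B m⁻¹)° = (⋂_{B' ⊇ T} B')° = T`
  (`identityComponent_iInf_borel_eq`, Milne 17.56), so `T · U_α` has finite index in the connected `B`;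
* **`exists_rootHom_sup_isBorelIn_of_central_holds`** — discharge of the named fact of
  `RootSubgroupProofs.lean` (**Springer 7.3.3 (ii)** with 7.3.2: `T · U_α` and
  `T · U_{-α} = m⁻¹ (T · U_α) m` are two distinct Borel subgroups, `x ↦ m⁻¹ u(x) m` being a root
  homomorphism for `-α`).

## References

* [SpringerLAG1998] T. A. Springer, *Linear Algebraic Groups*, 2nd ed. (1998): 5.5.3, 6.2.7,
  6.4.8, 6.4.12, 7.1.4–7.1.5, 7.2.2–7.2.3, 7.3.3, 7.6.3.
* [Milne2017] J. S. Milne, *Algebraic Groups*, CUP (2017), 17.56.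
-/

open scoped MatrixGroups IsMulCommutative
open Matrix

namespace Literature.NumberTheory.Automorphic

variable {k : Type*} [Field k] {n : Type*} [Fintype n] [DecidableEq n]

attribute [local instance] zariskiTopologyPi

/-! ### The affine slice through `z₀` and its finite fibres -/

section Slice

namespace RankOneBorelData

open RankOneOrbitData (rho_mul_mulVec rho_mulVec_mem v_mem)

variable {G T B : Subgroup (GL n k)} {α : ↥(characterLattice T)} {u : Multiplicative k →* ↥G}
  {m : GL n k} {N : ℕ} {ρ : ↥G →* GL (Fin N) k} {v : Fin N → k}
variable (h : RankOneBorelData G T B α u m ρ v)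
include h

/-- A coordinate `i₀` in the support of `z₀`. [folklore] -/
noncomputable def i0 : Fin N := (Function.ne_iff.1 h.z0_ne_zero).choose

/-- `z₀(i₀) ≠ 0`. [folklore] -/
theorem z0_i0 : h.z0 h.i0 ≠ 0 := fun h0 =>
  (Function.ne_iff.1 h.z0_ne_zero).choose_spec (by rw [Pi.zero_apply]; exact h0)

/-- A coordinate `j₀` in the support of `v`. [folklore] -/
noncomputable def j0 : Fin N := (Function.ne_iff.1 h.ne_zero).choose

/-- `v(j₀) ≠ 0`. [folklore] -/
theorem v_j0 : v h.j0 ≠ 0 := fun h0 =>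
  (Function.ne_iff.1 h.ne_zero).choose_spec (by rw [Pi.zero_apply]; exact h0)

/-- **The affine slice** `A = {w ∈ C | w(i₀) = z₀(i₀)}` of the orbit cone: a copy of the open
subset `Ω_∞ ∩ X = X ∖ {x₀}` of `X = G · [v]` (Springer 7.1.5's affine chart at `y_∞`).
[cite: SpringerLAG1998, 7.1.5 (proof)] -/
def slice : Set (Fin N → k) := {w | w ∈ orbitCone ρ.range v ∧ w h.i0 = h.z0 h.i0}

/-- Membership in the slice. [folklore] -/
theorem mem_slice_iff {w : Fin N → k} : w ∈ h.slice ↔ w ∈ orbitCone ρ.range v ∧ w h.i0 = h.z0 h.i0 :=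
  Iff.rfl

/-- The slice is closed. [folklore] -/
theorem isClosed_slice : IsClosed h.slice := by
  have h1 : IsClosed {w : Fin N → k | MvPolynomial.eval w
      (MvPolynomial.X h.i0 - MvPolynomial.C (h.z0 h.i0)) = 0} := isClosed_setOf_eval_eq_zero _
  convert h.closed.inter h1 using 1
  ext w
  simp [slice, sub_eq_zero]

/-- `z₀` lies in the slice. [folklore] -/
theorem z0_mem_slice : h.z0 ∈ h.slice := ⟨h.z0_mem, rfl⟩

/-- Points of the slice are non-zero and are not multiples of `v`: a multiple `c v` in the slice
would have `c v(i₀) = z₀(i₀) ≠ 0`, but `v(i₀) = 0` since `i₀` has weight `M_∞ ≠ M₀`. [folklore] -/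
theorem not_smul_v_of_mem_slice [IsAlgClosed k] {w : Fin N → k} (hw : w ∈ h.slice) :
    w ≠ 0 ∧ ¬ ∃ c : k, w = c • v := by
  haveI : IsMulCommutative ↥T := h.torus.2.1
  obtain ⟨γ, hd⟩ := h.exists_cochar_pos
  have hvi : v h.i0 = 0 := by
    by_contra hvi
    have e1 := h.wtInt_eq_Mv (γ := γ) hvi
    have e2 := h.wtInt_eq_Mz (γ := γ) h.z0_i0
    exact absurd (e1.symm.trans e2) (ne_of_gt (h.Mz_lt_Mv hd))
  constructor
  · intro h0
    have := hw.2
    rw [h0] at this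
    exact h.z0_i0 this.symm
  · rintro ⟨c, rfl⟩
    have := hw.2
    rw [Pi.smul_apply, hvi, smul_zero] at this
    exact h.z0_i0 this.symm

/-- **The fibres of the top coordinate `w ↦ w(j₀)` on the slice are finite** (finiteness lemma
`IsConeSet.finite_sep_dotProduct_eq_one` for the closed cone `C ∩ {z₀(i₀) w(j₀) = c w(i₀)}`, which
meets `w(i₀) = 0` only in `0` by the chart `exists_low_coords`). [cite: SpringerLAG1998, 6.1.2 (vi)] -/
theorem finite_fibre [IsAlgClosed k] (c : k) : {w ∈ h.slice | w h.j0 = c}.Finite := by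
  classical
  haveI : IsMulCommutative ↥T := h.torus.2.1
  obtain ⟨γ, hd⟩ := h.exists_cochar_pos
  set D : Set (Fin N → k) := {w | w ∈ orbitCone ρ.range v ∧ h.z0 h.i0 * w h.j0 = c * w h.i0}
    with hD
  have hDcone : IsConeSet D := by
    intro a _ w hw
    refine ⟨isConeSet_orbitCone a ‹_› w hw.1, ?_⟩
    simp only [Pi.smul_apply, smul_eq_mul]
    rw [mul_left_comm, hw.2, mul_left_comm]
  have hDcl : IsClosed D := by
    have h1 : IsClosed {w : Fin N → k | MvPolynomial.eval w
        (MvPolynomial.C (h.z0 h.i0) * MvPolynomial.X h.j0 - MvPolynomial.C c * MvPolynomial.X h.i0) = 0} :=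
      isClosed_setOf_eval_eq_zero _
    convert h.closed.inter h1 using 1
    ext w
    simp [hD, sub_eq_zero]
  set a : Fin N → k := Pi.single h.i0 (h.z0 h.i0)⁻¹ with ha
  have hadot : ∀ w : Fin N → k, a ⬝ᵥ w = (h.z0 h.i0)⁻¹ * w h.i0 := fun w => by
    rw [ha, single_dotProduct]
  have hker : ∀ w ∈ D, a ⬝ᵥ w = 0 → w = 0 := by
    intro w hw h0
    rw [hadot, mul_eq_zero, inv_eq_zero] at h0
    have hwi : w h.i0 = 0 := h0.resolve_left h.z0_i0
    by_contra hw0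
    have hnv : ¬ ∃ c' : k, w = c' • v := by
      rintro ⟨c', rfl⟩
      have h2 := hw.2
      rw [hwi, mul_zero, Pi.smul_apply, smul_eq_mul, mul_eq_zero, mul_eq_zero] at h2
      rcases h2 with h2 | h2 | h2
      · exact h.z0_i0 h2
      · apply hw0; rw [h2, zero_smul]
      · exact h.v_j0 h2
    obtain ⟨c', hc', hlow⟩ := h.exists_low_coords hd hw.1 hw0 hnv
    have := hlow h.i0 (h.wtInt_eq_Mz h.z0_i0)
    rw [hwi] at this
    exact mul_ne_zero hc' h.z0_i0 this.symm
  refine (hDcone.finite_sep_dotProduct_eq_one hDcl a hker).subset ?_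
  rintro w ⟨⟨hwC, hwi⟩, hwj⟩
  refine ⟨⟨hwC, ?_⟩, ?_⟩
  · rw [hwj, hwi, mul_comm]
  · rw [hadot, hwi, inv_mul_cancel₀ h.z0_i0]

/-! #### Irreducibility of the slice -/

/-- The orbit map in coordinates: polynomials `Qᵢ` with `Qᵢ(g) = (ρ(g) v)ᵢ` for `g ∈ G`. [folklore] -/
theorem exists_poly_orbit :
    ∃ Q : Fin N → MvPolynomial (GLCoord n) k, ∀ (g : ↥G) (i : Fin N),
      MvPolynomial.eval (glCoordFun (g : GL n k)) (Q i) =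
        (((ρ g : GL (Fin N) k) : Matrix (Fin N) (Fin N) k) *ᵥ v) i := by
  obtain ⟨P, hP⟩ := h.algebraic
  refine ⟨fun i => ∑ j, P (Sum.inl (i, j)) * MvPolynomial.C (v j), fun g i => ?_⟩
  rw [map_sum, Matrix.mulVec, dotProduct]
  refine Finset.sum_congr rfl fun j _ => ?_
  rw [map_mul, MvPolynomial.eval_C, ← hP, glCoordFun_inl]

attribute [local instance] zariskiTopologyGL

/-- **The slice is irreducible.** It is the image of the open subset `G⁰ = {g ∈ G | (ρ(g) v)(i₀) ≠ 0}`
of the irreducible `G` under the rational map `φ(g) = (z₀(i₀)/(ρ(g) v)(i₀)) ρ(g) v`; the preimage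
of a closed `Z ⊆ kᴺ` under `φ` is cut out in `G⁰` by polynomials (clear denominators degree by
degree), so `φ(G⁰) ⊆ Z₁ ∪ Z₂` forces `G⁰ ⊆ φ⁻¹ Z₁` or `G⁰ ⊆ φ⁻¹ Z₂` (Springer 1.3.7 (ii):
an open subset of an irreducible variety is irreducible, and images of irreducibles).
[cite: SpringerLAG1998, 1.2.3] -/
theorem isIrreducible_slice [IsAlgClosed k] : IsIrreducible h.slice := by
  classical
  obtain ⟨Q, hQ⟩ := h.exists_poly_orbit
  set a : k := h.z0 h.i0 with ha
  have ha0 : a ≠ 0 := h.z0_i0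
  -- `G⁰`
  set U0 : Set (GL n k) := {x | MvPolynomial.eval (glCoordFun x) (Q h.i0) ≠ 0} with hU0
  have hU0open : IsOpen U0 := by
    have : U0 = (zeroLocusGL {Q h.i0})ᶜ := by
      ext x; simp [hU0, zeroLocusGL]
    rw [this]
    exact (isClosed_zeroLocusGL _).isOpen_compl
  have hG0irr : IsIrreducible (U0 ∩ (G : Set (GL n k))) := by
    refine isIrreducible_isOpen_inter h.conn.isIrreducible hU0open ⟨m, ?_, h.memG⟩
    show MvPolynomial.eval (glCoordFun ((⟨m, h.memG⟩ : ↥G) : GL n k)) (Q h.i0) ≠ 0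
    rw [hQ]
    exact ha0
  -- pulled-back polynomials: `p̃(g) = F(g)^D p(φ(g))` for `g ∈ G⁰`
  let pull : MvPolynomial (Fin N) k → MvPolynomial (GLCoord n) k := fun p =>
    ∑ d ∈ Finset.range (p.totalDegree + 1), MvPolynomial.C (a ^ d) * Q h.i0 ^ (p.totalDegree - d) *
      MvPolynomial.bind₁ Q (MvPolynomial.homogeneousComponent d p)
  have hpull : ∀ (p : MvPolynomial (Fin N) k) (g : ↥G),
      MvPolynomial.eval (glCoordFun (g : GL n k)) (Q h.i0) ≠ 0 →
      MvPolynomial.eval (glCoordFun (g : GL n k)) (pull p) =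
        MvPolynomial.eval (glCoordFun (g : GL n k)) (Q h.i0) ^ p.totalDegree *
          MvPolynomial.eval ((a / MvPolynomial.eval (glCoordFun (g : GL n k)) (Q h.i0)) •
            (((ρ g : GL (Fin N) k) : Matrix (Fin N) (Fin N) k) *ᵥ v)) p := by
    intro p g hF
    set F := MvPolynomial.eval (glCoordFun (g : GL n k)) (Q h.i0) with hFdef
    have hw : (fun i => MvPolynomial.eval (glCoordFun (g : GL n k)) (Q i)) =
        ((ρ g : GL (Fin N) k) : Matrix (Fin N) (Fin N) k) *ᵥ v := funext (hQ g)
    set w := (a / F) • (((ρ g : GL (Fin N) k) : Matrix (Fin N) (Fin N) k) *ᵥ v) with hwdef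
    have hsum : MvPolynomial.eval w p = ∑ d ∈ Finset.range (p.totalDegree + 1),
        MvPolynomial.eval w (MvPolynomial.homogeneousComponent d p) := by
      conv_lhs => rw [← MvPolynomial.sum_homogeneousComponent p]
      rw [map_sum]
    rw [hsum, Finset.mul_sum, map_sum]
    refine Finset.sum_congr rfl fun d hd => ?_
    rw [map_mul, map_mul, MvPolynomial.eval_C, map_pow, eval_bind₁', hw, hwdef,
      eval_smul_of_isHomogeneous (MvPolynomial.homogeneousComponent_isHomogeneous d p), ← hFdef]
    have hdle : d ≤ p.totalDegree := Nat.lt_succ_iff.1 (Finset.mem_range.1 hd)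
    obtain ⟨e, he⟩ := Nat.exists_eq_add_of_le hdle
    rw [he, Nat.add_sub_cancel_left, pow_add, div_pow]
    field_simp
  -- the irreducibility criterion
  refine ⟨⟨h.z0, h.z0_mem_slice⟩, isPreirreducible_iff_isClosed_union_isClosed.2 ?_⟩
  intro Z₁ Z₂ hZ₁ hZ₂ hsub
  obtain ⟨S₁, hS₁⟩ := isClosed_iff_exists_setOf_eval.1 hZ₁
  obtain ⟨S₂, hS₂⟩ := isClosed_iff_exists_setOf_eval.1 hZ₂
  set V₁ : Set (GL n k) := zeroLocusGL (pull '' S₁) with hV₁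
  set V₂ : Set (GL n k) := zeroLocusGL (pull '' S₂) with hV₂
  -- `φ(g)` for `g ∈ G⁰` lies in the slice
  have hφ : ∀ g : ↥G, MvPolynomial.eval (glCoordFun (g : GL n k)) (Q h.i0) ≠ 0 →
      (a / MvPolynomial.eval (glCoordFun (g : GL n k)) (Q h.i0)) •
        (((ρ g : GL (Fin N) k) : Matrix (Fin N) (Fin N) k) *ᵥ v) ∈ h.slice := by
    intro g hF
    refine ⟨⟨_, _, ⟨g, rfl⟩, rfl⟩, ?_⟩
    rw [Pi.smul_apply, smul_eq_mul, ← hQ g h.i0, div_mul_cancel₀ _ hF]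
  have hG0sub : U0 ∩ (G : Set (GL n k)) ⊆ V₁ ∪ V₂ := by
    rintro x ⟨hxU, hxG⟩
    have hF : MvPolynomial.eval (glCoordFun ((⟨x, hxG⟩ : ↥G) : GL n k)) (Q h.i0) ≠ 0 := hxU
    rcases hsub (hφ ⟨x, hxG⟩ hF) with hz | hz
    · left
      rintro _ ⟨p, hp, rfl⟩
      rw [show x = ((⟨x, hxG⟩ : ↥G) : GL n k) from rfl, hpull p ⟨x, hxG⟩ hF]
      rw [hS₁] at hz
      rw [hz p hp, mul_zero]
    · right
      rintro _ ⟨p, hp, rfl⟩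
      rw [show x = ((⟨x, hxG⟩ : ↥G) : GL n k) from rfl, hpull p ⟨x, hxG⟩ hF]
      rw [hS₂] at hz
      rw [hz p hp, mul_zero]
  -- from `G⁰ ⊆ V_l` to `slice ⊆ Z_l`
  have key : ∀ {S : Set (MvPolynomial (Fin N) k)} {Z : Set (Fin N → k)},
      Z = {x | ∀ p ∈ S, MvPolynomial.eval x p = 0} →
      U0 ∩ (G : Set (GL n k)) ⊆ zeroLocusGL (pull '' S) → h.slice ⊆ Z := by
    intro S Z hS hGV w hw
    obtain ⟨⟨c, _, ⟨g, rfl⟩, rfl⟩, hwi⟩ := hw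
    rw [Pi.smul_apply, smul_eq_mul] at hwi
    have hF : MvPolynomial.eval (glCoordFun (g : GL n k)) (Q h.i0) ≠ 0 := by
      rw [hQ]
      intro h0
      rw [h0, mul_zero] at hwi
      exact ha0 hwi.symm
    have hc : c = a / MvPolynomial.eval (glCoordFun (g : GL n k)) (Q h.i0) := by
      rw [eq_div_iff hF, hQ, hwi]
    have hgV := hGV ⟨hF, g.2⟩
    rw [hS]
    intro p hp
    have h1 := hgV (pull p) ⟨p, hp, rfl⟩
    rw [hpull p g hF, mul_eq_zero] at h1
    rcases h1 with h1 | h1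
    · exact absurd (pow_eq_zero_iff'.1 h1).1 hF
    · rw [hc]; exact h1
  rcases isPreirreducible_iff_isClosed_union_isClosed.1 hG0irr.2 V₁ V₂ (isClosed_zeroLocusGL _)
    (isClosed_zeroLocusGL _) hG0sub with hV | hV
  · exact Or.inl (key hS₁ hV)
  · exact Or.inr (key hS₂ hV)

end RankOneBorelData

end Slice

/-! ### The curve `U · z₀` fills the slice; the Bruhat decomposition -/

section Bruhat

namespace RankOneBorelData

open RankOneOrbitData (rho_mul_mulVec rho_mulVec_mem v_mem)

variable {G T B : Subgroup (GL n k)} {α : ↥(characterLattice T)} {u : Multiplicative k →* ↥G}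
  {m : GL n k} {N : ℕ} {ρ : ↥G →* GL (Fin N) k} {v : Fin N → k}
variable (h : RankOneBorelData G T B α u m ρ v)
include h

/-- The orbit curve `y ↦ ρ(u(y)) z₀` (Springer: `U n x₀ ⊂ G/B`). [cite: SpringerLAG1998, 7.2.2 (proof)] -/
noncomputable def orbitCurve (y : k) : Fin N → k :=
  ((ρ (u (Multiplicative.ofAdd y)) : GL (Fin N) k) : Matrix (Fin N) (Fin N) k) *ᵥ h.z0

/-- The orbit curve is injective (`ρ(u(y - y')) z₀ = z₀ ⇒ y = y'`). [folklore] -/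
theorem orbitCurve_injective [IsAlgClosed k] : Function.Injective h.orbitCurve := by
  intro y y' hyy
  have e : ((ρ (u (Multiplicative.ofAdd (y - y'))) : GL (Fin N) k) : Matrix (Fin N) (Fin N) k) *ᵥ
      h.z0 = h.z0 := by
    have := congrArg (fun w => ((ρ (u (Multiplicative.ofAdd (-y'))) : GL (Fin N) k) :
      Matrix (Fin N) (Fin N) k) *ᵥ w) hyy
    simp only [orbitCurve, ← rho_mul_mulVec, ← map_mul, ← ofAdd_add] at this
    rw [neg_add_cancel, ofAdd_zero, map_one, map_one, Units.val_one, Matrix.one_mulVec] at this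
    rw [sub_eq_add_neg, add_comm]
    exact this
  exact sub_eq_zero.1 (h.eq_zero_of_rho_uval_fix e)

/-- The orbit curve lies in the slice (`U_α` fixes the weight-`M_∞` coordinates of `z₀`). [folklore] -/
theorem orbitCurve_mem_slice [IsAlgClosed k] (y : k) : h.orbitCurve y ∈ h.slice := by
  haveI : IsMulCommutative ↥T := h.torus.2.1
  obtain ⟨γ, hd⟩ := h.exists_cochar_pos
  refine ⟨rho_mulVec_mem _ h.z0_mem, ?_⟩
  rw [orbitCurve, h.rho_uval_mulVec_apply hd (fun j hj => h.wtInt_eq_Mz hj) y h.i0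
    (h.wtInt_eq_Mz h.z0_i0).le, if_pos (h.wtInt_eq_Mz h.z0_i0)]

/-- The coordinates of the orbit curve are polynomials in `y`. [folklore] -/
theorem exists_polynomial_orbitCurve :
    ∃ q : Fin N → Polynomial k, ∀ y i, (q i).eval y = h.orbitCurve y i := by
  choose q hq using h.exists_polynomial_rho_uval
  refine ⟨fun i => ∑ j, q i j * Polynomial.C (h.z0 j), fun y i => ?_⟩
  rw [orbitCurve, Matrix.mulVec, dotProduct, Polynomial.eval_finsetSum]
  exact Finset.sum_congr rfl fun j _ => by rw [Polynomial.eval_mul, Polynomial.eval_C, hq]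

/-- **The orbit curve `U · z₀` is closed** (`isClosed_range_polyCurve`; it is non-constant, being
injective). [folklore] -/
theorem isClosed_range_orbitCurve [IsAlgClosed k] : IsClosed (Set.range h.orbitCurve) := by
  obtain ⟨q, hq⟩ := h.exists_polynomial_orbitCurve
  have hq' : ∃ i, 0 < (q i).natDegree := by
    by_contra hcon
    push Not at hcon
    have : h.orbitCurve 0 = h.orbitCurve 1 := by
      funext i
      rw [← hq, ← hq, Polynomial.eq_C_of_natDegree_le_zero (hcon i), Polynomial.eval_C,
        Polynomial.eval_C]
    exact zero_ne_one (h.orbitCurve_injective this)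
  have e : Set.range h.orbitCurve = Set.range fun y : k => fun i => (q i).eval y := by
    ext w; constructor <;> rintro ⟨y, rfl⟩ <;> exact ⟨y, funext fun i => by simp only [hq]⟩
  rw [e]
  exact isClosed_range_polyCurve q hq'

/-- **The top coordinate takes infinitely many values on the orbit curve**: `(ρ(u(y)) z₀)(j₀)` is a
polynomial in `y` vanishing at `y = 0` (`z₀` has no weight-`M₀` coordinate) and non-zero for
`y ≠ 0` (the weight-`M₀` part of a point of the cone off the line `k z₀` is a non-zero multiple
of `v`, `exists_high_coords`). [cite: SpringerLAG1998, 7.1.5 (proof)] -/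
theorem infinite_image_orbitCurve [IsAlgClosed k] :
    ((fun w : Fin N → k => MvPolynomial.eval w (MvPolynomial.X h.j0)) '' Set.range h.orbitCurve).Infinite := by
  classical
  haveI : IsMulCommutative ↥T := h.torus.2.1
  obtain ⟨γ, hd⟩ := h.exists_cochar_pos
  obtain ⟨q, hq⟩ := h.exists_polynomial_orbitCurve
  -- the coordinate `j₀` along the curve
  have hzj : h.z0 h.j0 = 0 := by
    by_contra hzj
    exact absurd ((h.wtInt_eq_Mv (γ := γ) h.v_j0).symm.trans (h.wtInt_eq_Mz hzj))
      (ne_of_gt (h.Mz_lt_Mv hd))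
  have h0 : (q h.j0).eval 0 = 0 := by
    rw [hq, orbitCurve, ofAdd_zero, map_one, map_one, Units.val_one, Matrix.one_mulVec, hzj]
  have hne : ∀ y ≠ 0, (q h.j0).eval y ≠ 0 := by
    intro y hy
    have hw : h.orbitCurve y ∈ orbitCone ρ.range v := (h.orbitCurve_mem_slice y).1
    have hw0 : h.orbitCurve y ≠ 0 := (h.not_smul_v_of_mem_slice (h.orbitCurve_mem_slice y)).1
    have hnz : ¬ ∃ c : k, h.orbitCurve y = c • h.z0 := by
      rintro ⟨c, hc⟩
      have hc1 : c = 1 := by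
        have := congrFun hc h.i0
        rw [(h.orbitCurve_mem_slice y).2, Pi.smul_apply, smul_eq_mul] at this
        have := mul_right_cancel₀ h.z0_i0 (this.symm.trans (one_mul _).symm)
        exact this
      rw [hc1, one_smul] at hc
      have h00 : h.orbitCurve 0 = h.z0 := by
        rw [orbitCurve, ofAdd_zero, map_one, map_one, Units.val_one, Matrix.one_mulVec]
      exact hy (h.orbitCurve_injective (hc.trans h00.symm))
    obtain ⟨c, hc, hhigh⟩ := h.exists_high_coords hd hw hw0 hnz
    rw [hq, hhigh h.j0 (h.wtInt_eq_Mv h.v_j0)]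
    exact mul_ne_zero hc h.v_j0
  -- a polynomial vanishing at `0` and nowhere else on `kˣ`... takes infinitely many values
  have himage : (fun w : Fin N → k => MvPolynomial.eval w (MvPolynomial.X h.j0)) '' Set.range h.orbitCurve =
      Set.range fun y : k => (q h.j0).eval y := by
    ext c
    simp only [Set.mem_image, Set.mem_range, MvPolynomial.eval_X]
    constructor
    · rintro ⟨_, ⟨y, rfl⟩, rfl⟩; exact ⟨y, hq y h.j0⟩
    · rintro ⟨y, rfl⟩; exact ⟨_, ⟨y, rfl⟩, (hq y h.j0).symm⟩
  rw [himage]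
  intro hfin
  -- finitely many values `c`, each with finitely many preimages (the polynomial is non-constant)
  have hq0 : q h.j0 ≠ Polynomial.C ((q h.j0).eval 1) := by
    intro e
    have := hne 1 one_ne_zero
    rw [e, Polynomial.eval_C] at h0
    exact this h0
  have hcover : (Set.univ : Set k) ⊆ ⋃ c ∈ hfin.toFinset, {y : k | (q h.j0).eval y = c} := by
    intro y _
    simp only [Set.mem_iUnion, Set.mem_setOf_eq, Set.Finite.mem_toFinset, Set.mem_range,
      exists_prop]
    exact ⟨_, ⟨y, rfl⟩, rfl⟩
  have hfin' : (Set.univ : Set k).Finite := by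
    refine Set.Finite.subset (Set.Finite.biUnion hfin.toFinset.finite_toSet fun c _ => ?_) hcover
    -- roots of `q - C c`
    have hqc : q h.j0 - Polynomial.C c ≠ 0 := by
      intro e
      rw [sub_eq_zero] at e
      apply hq0
      rw [e, Polynomial.eval_C]
    refine ((q h.j0 - Polynomial.C c).roots.toFinset.finite_toSet).subset fun y hy => ?_
    have hy' : (q h.j0).eval y = c := hy
    simp only [Finset.mem_coe, Multiset.mem_toFinset, Polynomial.mem_roots hqc, Polynomial.IsRoot.def,
      Polynomial.eval_sub, Polynomial.eval_C, hy', sub_self]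
  exact Set.infinite_univ hfin'

/-- **`X ∖ {x₀} = U · x_∞`**: the slice equals the orbit curve (the curve criterion
`eq_of_isClosed_of_infinite_image`: the slice is closed and irreducible with finite fibres of the
coordinate `j₀`, and contains the closed curve `U · z₀` on which `j₀` takes infinitely many
values); the `k`-points content of Springer 7.2.2, proof (via 7.1.2 and 7.1.5: `G/B ≅ ℙ¹` and
`U ∩ n B n⁻¹ = {e}`, so `U n x₀` is the complement of `x₀`). [cite: SpringerLAG1998, 7.2.2 (proof)] -/
theorem range_orbitCurve_eq_slice [IsAlgClosed k] : Set.range h.orbitCurve = h.slice :=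
  eq_of_isClosed_of_infinite_image h.isClosed_slice h.isIrreducible_slice (MvPolynomial.X h.j0)
    (fun c => by simpa only [MvPolynomial.eval_X] using h.finite_fibre c)
    h.isClosed_range_orbitCurve (by rintro _ ⟨y, rfl⟩; exact h.orbitCurve_mem_slice y)
    h.infinite_image_orbitCurve

/-- **The Bruhat decomposition in semisimple rank one** (Springer 7.2.2 (i): "*`G` is the disjoint
union of `B` and `U n B`*"): every `g ∈ G ∖ B` is `u(y) m b` with `b ∈ B`. From the data: `ρ(g) v`
lies in the orbit cone off the line `k v`, so after normalising its `i₀`-coordinate it lies in the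
slice, i.e. equals `ρ(u(y) m) v` up to the scalar; hence `(u(y) m)⁻¹ g` stabilises the line of `v`
and lies in `B`. [cite: SpringerLAG1998, 7.2.2 (i)] -/
theorem bruhat [IsAlgClosed k] {g : GL n k} (hg : g ∈ G) (hgB : g ∉ B) :
    ∃ (y : k) (b : GL n k), b ∈ B ∧ g = uval u y * m * b := by
  haveI : IsMulCommutative ↥T := h.torus.2.1
  obtain ⟨γ, hd⟩ := h.exists_cochar_pos
  set w := ((ρ ⟨g, hg⟩ : GL (Fin N) k) : Matrix (Fin N) (Fin N) k) *ᵥ v with hw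
  have hwC : w ∈ orbitCone ρ.range v := rho_mulVec_mem _ v_mem
  have hw0 : w ≠ 0 := by
    intro h0
    apply h.ne_zero
    have := congrArg (fun z => (((ρ ⟨g, hg⟩ : GL (Fin N) k)⁻¹ : GL (Fin N) k) :
      Matrix (Fin N) (Fin N) k) *ᵥ z) h0
    simpa [hw, Matrix.mulVec_mulVec, ← Units.val_mul] using this
  have hnv : ¬ ∃ c : k, w = c • v := fun hc => hgB ((h.stab_iff ⟨g, hg⟩).1 hc)
  obtain ⟨c, hc, hlow⟩ := h.exists_low_coords hd hwC hw0 hnv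
  set a := h.z0 h.i0 with ha
  have hF : w h.i0 = c * a := hlow h.i0 (h.wtInt_eq_Mz h.z0_i0)
  -- normalise into the slice
  have hmem : c⁻¹ • w ∈ h.slice := by
    refine ⟨isConeSet_orbitCone _ (inv_ne_zero hc) _ hwC, ?_⟩
    rw [Pi.smul_apply, smul_eq_mul, hF, inv_mul_cancel_left₀ hc]
  rw [← h.range_orbitCurve_eq_slice] at hmem
  obtain ⟨y, hy⟩ := hmem
  -- `ρ((u(y) m)⁻¹ g) v = c v`
  have key : ∃ c' : k, ((ρ ((u (Multiplicative.ofAdd y) * ⟨m, h.memG⟩)⁻¹ * ⟨g, hg⟩) : GL (Fin N) k) :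
      Matrix (Fin N) (Fin N) k) *ᵥ v = c' • v := by
    refine ⟨c, ?_⟩
    rw [rho_mul_mulVec, ← hw, show w = c • h.orbitCurve y by
      rw [hy, smul_smul, mul_inv_cancel₀ hc, one_smul], Matrix.mulVec_smul, orbitCurve, z0,
      ← rho_mul_mulVec, ← rho_mul_mulVec, mul_assoc, inv_mul_cancel, map_one, Units.val_one,
      Matrix.one_mulVec]
  have hb := (h.stab_iff _).1 key
  refine ⟨y, (uval u y * m)⁻¹ * g, by simpa [uval] using hb, ?_⟩
  group

end RankOneBorelData

end Bruhat

/-! ### Producing the data for a connected reductive group (Springer 7.6.3 via Luna, 6.4.8 (ii)) -/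

section Existence

variable {G T : Subgroup (GL n k)}

/-- The image of a root homomorphism is non-trivial (`u` is injective). [folklore] -/
theorem IsRootHom.map_range_ne_bot {hTG : T ≤ G} {α : ↥T →* kˣ} {u : Multiplicative k →* ↥G}
    (hu : IsRootHom G T hTG α u) : u.range.map G.subtype ≠ ⊥ := by
  intro h0
  have h1 : uval u 1 ∈ u.range.map G.subtype := ⟨u (Multiplicative.ofAdd 1), ⟨_, rfl⟩, rfl⟩
  rw [h0, Subgroup.mem_bot, uval_eq_one_iff hu.injective] at h1
  exact one_ne_zero h1

/-- **A Weyl element outside `B`** (Springer 7.1.5 (i): "*`W` has order two*"): for a connected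
reductive `G`, a maximal torus `T`, a root homomorphism `u` and a Borel subgroup `B ⊇ T · U_α`
there is `m ∈ N_G(T) ∩ G` with `m ∉ B`. Otherwise every Borel subgroup containing `T`, being
`x B x⁻¹` with `x ∈ N_G(T)` (`exists_mem_normalizer_map_conj_eq_of_isBorelIn`), equals `B`, so
`U_α` lies in all of them and is trivial by Chevalley's theorem on the unipotent radical
(`unipotent_eq_bot_of_forall_isBorelIn_le_holds`, 7.6.3). [cite: SpringerLAG1998, 7.1.5 (i)] -/
theorem exists_mem_normalizer_not_mem [IsAlgClosed k] {B : Subgroup (GL n k)}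
    (hG : IsConnectedReductive G) (hT : IsMaximalTorusIn T G) {α : ↥(characterLattice T)}
    {u : Multiplicative k →* ↥G} (hu : IsRootHom G T hT.1 (α : ↥T →* kˣ) u)
    (hB : IsBorelIn B G) (hTB : T ≤ B) (hUB : u.range.map G.subtype ≤ B) :
    ∃ m ∈ G, m ∈ Subgroup.normalizer (T : Set (GL n k)) ∧ m ∉ B := by
  by_contra hcon
  push Not at hcon
  have hall : ∀ B' : Subgroup (GL n k), IsBorelIn B' G → T ≤ B' → u.range.map G.subtype ≤ B' := by
    intro B' hB' hTB'
    obtain ⟨x, hxG, hxN, rfl⟩ :=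
      exists_mem_normalizer_map_conj_eq_of_isBorelIn hG.1 hT hB hTB hB' hTB'
    rw [RankOneOrbitData.map_conj_eq_of_mem (hcon x hxG hxN)]
    exact hUB
  exact hu.map_range_ne_bot (unipotent_eq_bot_of_forall_isBorelIn_le_holds hG hT
    (Subgroup.map_subtype_le _) (hu.isZConnected_map_range hG.1.1)
    hu.1.isUnipotentSubgroup_map_range hall)

/-- **The Borel subgroups containing `T` are `B` and `m B m⁻¹`** (Springer 7.1.4 with 6.4.12), for
`G` connected with a maximal torus `T`, a non-trivial `α ∈ X*(T)` with `(Ker α)°` central, a Borel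
subgroup `B ⊇ T` containing `Z_G(T)` and `m ∈ N_G(T) ∩ G ∖ B`: a Borel subgroup `B' ⊇ T` is
`x B x⁻¹` with `x ∈ N_G(T) ⊆ Z_G(T) ∪ m Z_G(T)`. [cite: SpringerLAG1998, 7.1.4 with 6.4.12] -/
theorem borel_eq_or_eq_map_conj [IsAlgClosed k] {B : Subgroup (GL n k)} (hG : IsZConnected G)
    (hT : IsMaximalTorusIn T G) {α : ↥(characterLattice T)} (hα1 : (α : ↥T →* kˣ) ≠ 1)
    (hcen : G ≤ Subgroup.centralizer
      ((identityComponent ((α : ↥T →* kˣ).ker.map T.subtype) : Subgroup (GL n k)) : Set (GL n k)))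
    (hB : IsBorelIn B G) (hTB : T ≤ B) (hZB : G ⊓ Subgroup.centralizer (T : Set (GL n k)) ≤ B)
    {m : GL n k} (hmG : m ∈ G) (hmN : m ∈ Subgroup.normalizer (T : Set (GL n k))) (hmB : m ∉ B)
    {B' : Subgroup (GL n k)} (hB' : IsBorelIn B' G) (hTB' : T ≤ B') :
    B' = B ∨ B' = B.map (MulAut.conj m : GL n k →* GL n k) := by
  have hmZ : m ∉ Subgroup.centralizer (T : Set (GL n k)) := fun h =>
    hmB (hZB (Subgroup.mem_inf.2 ⟨hmG, h⟩))
  obtain ⟨x, hxG, hxN, rfl⟩ := exists_mem_normalizer_map_conj_eq_of_isBorelIn hG hT hB hTB hB' hTB'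
  rcases mem_centralizer_or_of_mem_normalizer_of_central hG.1 hT.2.1 hα1 hcen hmG hmN hmZ hxG hxN
    with h1 | h1
  · exact Or.inl (RankOneOrbitData.map_conj_eq_of_mem (hZB (Subgroup.mem_inf.2 ⟨hxG, h1⟩)))
  · right
    have hz : m⁻¹ * x ∈ B := hZB (Subgroup.mem_inf.2 ⟨G.mul_mem (G.inv_mem hmG) hxG, h1⟩)
    calc B.map (MulAut.conj x : GL n k →* GL n k)
        = B.map (MulAut.conj (m * (m⁻¹ * x)) : GL n k →* GL n k) := by rw [mul_inv_cancel_left]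
      _ = (B.map (MulAut.conj (m⁻¹ * x) : GL n k →* GL n k)).map
            (MulAut.conj m : GL n k →* GL n k) := by rw [map_conj_map_conj]
      _ = B.map (MulAut.conj m : GL n k →* GL n k) := by
          rw [RankOneOrbitData.map_conj_eq_of_mem hz]

/-- **`U_α ∩ m B m⁻¹ = {e}`** (Springer 7.2.3 (i): "*`U ∩ n U n⁻¹ = {e}`*"), for `G` connected
reductive, in the situation of `borel_eq_or_eq_map_conj` with `U_α ≤ B`: if `m⁻¹ u(y) m ∈ B` with
`y ≠ 0` then, conjugating by `T ⊆ m B m⁻¹` and using `α(T) = kˣ`, all of `U_α` lies in `m B m⁻¹`,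
hence in every Borel subgroup containing `T`, contradicting Chevalley's theorem on the unipotent
radical (`unipotent_eq_bot_of_forall_isBorelIn_le_holds`, 7.6.3). [cite: SpringerLAG1998, 7.2.3 (i)] -/
theorem eq_zero_of_conj_uval_mem [IsAlgClosed k] {B : Subgroup (GL n k)}
    (hG : IsConnectedReductive G) (hT : IsMaximalTorusIn T G) {α : ↥(characterLattice T)}
    (hα : α ∈ roots G T)
    (hcen : G ≤ Subgroup.centralizer
      ((identityComponent ((α : ↥T →* kˣ).ker.map T.subtype) : Subgroup (GL n k)) : Set (GL n k)))
    {u : Multiplicative k →* ↥G} (hu : IsRootHom G T hT.1 (α : ↥T →* kˣ) u)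
    (hB : IsBorelIn B G) (hTB : T ≤ B) (hUB : u.range.map G.subtype ≤ B)
    (hZB : G ⊓ Subgroup.centralizer (T : Set (GL n k)) ≤ B)
    {m : GL n k} (hmG : m ∈ G) (hmN : m ∈ Subgroup.normalizer (T : Set (GL n k))) (hmB : m ∉ B)
    {y : k} (hy : m⁻¹ * uval u y * m ∈ B) : y = 0 := by
  by_contra hy0
  -- `U_α ≤ m B m⁻¹`
  have hUB' : u.range.map G.subtype ≤ B.map (MulAut.conj m : GL n k →* GL n k) := by
    rintro _ ⟨_, ⟨x, rfl⟩, rfl⟩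
    change uval u (Multiplicative.toAdd x) ∈ B.map (MulAut.conj m : GL n k →* GL n k)
    set x' := Multiplicative.toAdd x
    rw [mem_map_conj_iff]
    by_cases hx0 : x' = 0
    · rw [hx0, uval_zero, mul_one, inv_mul_cancel]
      exact B.one_mem
    obtain ⟨t, ht⟩ := surjective_of_mem_roots hT.2.1 hα (Units.mk0 (x' / y) (div_ne_zero hx0 hy0))
    have e : uval u x' = (t : GL n k) * uval u y * (t : GL n k)⁻¹ := by
      rw [hu.conj_uval t y, ht, Units.val_mk0, div_mul_cancel₀ x' hy0]
    have htm : m⁻¹ * (t : GL n k) * m ∈ T := (Subgroup.mem_normalizer_iff''.1 hmN _).1 t.2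
    rw [e, show m⁻¹ * ((t : GL n k) * uval u y * (t : GL n k)⁻¹) * m =
      m⁻¹ * (t : GL n k) * m * (m⁻¹ * uval u y * m) * (m⁻¹ * (t : GL n k) * m)⁻¹ by group]
    exact B.mul_mem (B.mul_mem (hTB htm) hy) (B.inv_mem (hTB htm))
  -- so `U_α` lies in every Borel subgroup containing `T`
  have hall : ∀ B' : Subgroup (GL n k), IsBorelIn B' G → T ≤ B' → u.range.map G.subtype ≤ B' := by
    intro B' hB' hTB'
    rcases borel_eq_or_eq_map_conj hG.1 hT hα.1 hcen hB hTB hZB hmG hmN hmB hB' hTB' with rfl | rfl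
    · exact hUB
    · exact hUB'
  exact hu.map_range_ne_bot (unipotent_eq_bot_of_forall_isBorelIn_le_holds hG hT
    (Subgroup.map_subtype_le _) (hu.isZConnected_map_range hG.1.1)
    hu.1.isUnipotentSubgroup_map_range hall)

/-- **Existence of the data `RankOneBorelData`** for a connected reductive `G`, a maximal torus `T`,
a root `α` with `(Ker α)°` central, a root homomorphism `u` and a Borel subgroup `B ⊇ T · U_α`:
`Z_G(T) ⊆ B` (6.4.8 (ii), `centralizer_le_of_isBorelIn_holds`), the Weyl element
(`exists_mem_normalizer_not_mem`), `U_α ∩ m B m⁻¹ = {e}` (`eq_zero_of_conj_uval_mem`), Chevalley's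
representation 5.5.3 (`exists_isAlgebraicGL_lineStabilizer_eq`) with `ρ(T)` diagonalised
(`exists_conj_le_diagonalSubgroup`) and closed orbit cone (6.2.7 (ii),
`isClosed_orbitCone_of_borel_le_lineStabilizer_holds`). [cite: SpringerLAG1998, 7.1.5 (proof)] -/
theorem exists_rankOneBorelData [IsAlgClosed k] {B : Subgroup (GL n k)}
    (hG : IsConnectedReductive G) (hT : IsMaximalTorusIn T G) {α : ↥(characterLattice T)}
    (hα : α ∈ roots G T)
    (hcen : G ≤ Subgroup.centralizer
      ((identityComponent ((α : ↥T →* kˣ).ker.map T.subtype) : Subgroup (GL n k)) : Set (GL n k)))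
    {u : Multiplicative k →* ↥G} (hu : IsRootHom G T hT.1 (α : ↥T →* kˣ) u)
    (hB : IsBorelIn B G) (hTB : T ≤ B) (hUB : u.range.map G.subtype ≤ B) :
    ∃ (m : GL n k) (N : ℕ) (ρ : ↥G →* GL (Fin N) k) (v : Fin N → k),
      RankOneBorelData G T B α u m ρ v := by
  classical
  have hTtorus : IsTorusSubgroup T := hT.2.1
  haveI : IsMulCommutative ↥T := hTtorus.2.1
  have hZB : G ⊓ Subgroup.centralizer (T : Set (GL n k)) ≤ B :=
    centralizer_le_of_isBorelIn_holds hG.1 hT hB hTB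
  obtain ⟨m, hmG, hmN, hmB⟩ := exists_mem_normalizer_not_mem hG hT hu hB hTB hUB
  -- Chevalley 5.5.3 for `B`
  obtain ⟨N, ρ, v, hρ, hv0, hstab⟩ := exists_isAlgebraicGL_lineStabilizer_eq (H := B) G hB.2.1.1
  -- diagonalise `ρ(T)`
  set Tρ : Subgroup (GL (Fin N) k) := (T.subgroupOf G).map ρ with hTρ
  have hmemTρ : ∀ {x : GL (Fin N) k}, x ∈ Tρ ↔ ∃ g : ↥G, (g : GL n k) ∈ T ∧ ρ g = x := by
    intro x
    simp only [hTρ, Subgroup.mem_map, Subgroup.mem_subgroupOf]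
  have hcommρ : IsMulCommutative ↥Tρ := by
    refine ⟨⟨fun a b => Subtype.ext ?_⟩⟩
    obtain ⟨g, hg, hga⟩ := hmemTρ.1 a.2
    obtain ⟨g', hg', hgb⟩ := hmemTρ.1 b.2
    rw [Subgroup.coe_mul, Subgroup.coe_mul, ← hga, ← hgb, ← map_mul, ← map_mul]
    congr 1
    exact Subtype.ext (by
      have := congrArg Subtype.val (mul_comm (⟨(g : GL n k), hg⟩ : ↥T) ⟨(g' : GL n k), hg'⟩)
      simpa using this)
  have hssρ : ∀ x ∈ Tρ, IsSemisimpleElt x := by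
    intro x hx
    obtain ⟨g, hg, rfl⟩ := hmemTρ.1 hx
    have := IsSemisimpleElt.map_of_isAlgebraicGL hρ g.2 (hTtorus.2.2 _ hg)
    exact this
  obtain ⟨P, hP⟩ := exists_conj_le_diagonalSubgroup hcommρ hssρ
  -- the conjugated data
  set ρ' : ↥G →* GL (Fin N) k := (MulAut.conj P).toMonoidHom.comp ρ with hρ'
  set v' : Fin N → k := ((P : GL (Fin N) k) : Matrix (Fin N) (Fin N) k) *ᵥ v with hv'
  have hρ'apply : ∀ g : ↥G, ((ρ' g : GL (Fin N) k) : Matrix (Fin N) (Fin N) k) =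
      (P : Matrix (Fin N) (Fin N) k) * (ρ g : Matrix (Fin N) (Fin N) k) *
        ((P⁻¹ : GL (Fin N) k) : Matrix (Fin N) (Fin N) k) := by
    intro g
    simp [hρ', MulAut.conj_apply]
  have hstab' : ∀ g : ↥G, (∃ c : k, ((ρ' g : GL (Fin N) k) : Matrix (Fin N) (Fin N) k) *ᵥ v' = c • v') ↔
      (g : GL n k) ∈ B := by
    intro g
    rw [← hstab g, hρ'apply, hv']
    have hPP : ((P⁻¹ : GL (Fin N) k) : Matrix (Fin N) (Fin N) k) * (P : Matrix (Fin N) (Fin N) k) = 1 := by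
      rw [← Units.val_mul, inv_mul_cancel, Units.val_one]
    constructor
    · rintro ⟨c, hc⟩
      refine ⟨c, ?_⟩
      rw [Matrix.mulVec_mulVec, mul_assoc, hPP, mul_one] at hc
      have := congrArg (fun w => ((P⁻¹ : GL (Fin N) k) : Matrix (Fin N) (Fin N) k) *ᵥ w) hc
      rwa [Matrix.mulVec_mulVec, ← mul_assoc, hPP, one_mul, Matrix.mulVec_smul, Matrix.mulVec_mulVec,
        hPP, Matrix.one_mulVec] at this
    · rintro ⟨c, hc⟩
      refine ⟨c, ?_⟩
      rw [Matrix.mulVec_mulVec, mul_assoc, hPP, mul_one, ← Matrix.mulVec_mulVec, hc,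
        Matrix.mulVec_smul]
  refine ⟨m, N, ρ', v', {
    conn := hG.1
    maxTorus := hT
    mem_roots := hα
    central := hcen
    rootHom := hu
    borel := hB
    torus_le := hTB
    range_le := hUB
    centralizer_le := hZB
    memG := hmG
    memN := hmN
    notMemB := hmB
    inter := fun y hy => eq_zero_of_conj_uval_mem hG hT hα hcen hu hB hTB hUB hZB hmG hmN hmB hy
    algebraic := hρ.conj_comp P
    ne_zero := ?_
    stab_iff := hstab'
    diag := ?_
    closed := ?_ }⟩
  · intro h0
    apply hv0
    have := congrArg (fun w => ((P⁻¹ : GL (Fin N) k) : Matrix (Fin N) (Fin N) k) *ᵥ w) h0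
    simpa [hv', Matrix.mulVec_mulVec, ← Units.val_mul] using this
  · intro t
    have hmem : ρ' ⟨t, hT.1 t.2⟩ ∈ Tρ.map (MulAut.conj P).toMonoidHom :=
      Subgroup.mem_map_of_mem _ (hmemTρ.2 ⟨⟨t, hT.1 t.2⟩, t.2, rfl⟩)
    obtain ⟨d, hd⟩ := hP hmem
    refine ⟨fun i => (d i : k), ?_⟩
    rw [← hd, coe_diagonalGL]
  · exact isClosed_orbitCone_of_borel_le_lineStabilizer_holds hG.1 hB ρ' (hρ.conj_comp P) v'
      fun b hb => (hstab' b).2 hb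

end Existence

/-! ### `B = T · U_α` -/

section BorelEq

namespace RankOneBorelData

open RankOneOrbitData (rho_mul_mulVec rho_mulVec_mem v_mem)

variable {G T B : Subgroup (GL n k)} {α : ↥(characterLattice T)} {u : Multiplicative k →* ↥G}
  {m : GL n k} {N : ℕ} {ρ : ↥G →* GL (Fin N) k} {v : Fin N → k}
variable (h : RankOneBorelData G T B α u m ρ v)
include h

/-- The Borel subgroups containing `T` are `B` and `m B m⁻¹` (`borel_eq_or_eq_map_conj`). [cite: SpringerLAG1998, 7.1.4 with 6.4.12] -/
theorem borel_eq_or [IsAlgClosed k] {B' : Subgroup (GL n k)} (hB' : IsBorelIn B' G) (hTB' : T ≤ B') :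
    B' = B ∨ B' = B.map (MulAut.conj m : GL n k →* GL n k) :=
  borel_eq_or_eq_map_conj h.conn h.maxTorus h.ne_one h.central h.borel h.torus_le h.centralizer_le
    h.memG h.memN h.notMemB hB' hTB'

/-- **`B ⊆ U_α · (B ∩ m B m⁻¹)`** (from Bruhat: for `b ∈ B`, `b m ∉ B`, so `b m = u(y) m b'` and
`u(y)⁻¹ b = m b' m⁻¹`). [cite: SpringerLAG1998, 7.2.2–7.2.3] -/
theorem exists_eq_uval_mul [IsAlgClosed k] {b : GL n k} (hb : b ∈ B) :
    ∃ (y : k) (x : GL n k), x ∈ B ∧ m⁻¹ * x * m ∈ B ∧ b = uval u y * x := by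
  have hbm : b * m ∉ B := fun h' => h.notMemB (by simpa using B.mul_mem (B.inv_mem hb) h')
  obtain ⟨y, b', hb', e⟩ := h.bruhat (G.mul_mem (h.borel.1 hb) h.memG) hbm
  refine ⟨y, (uval u y)⁻¹ * b, B.mul_mem (B.inv_mem (h.range_le ?_)) hb, ?_, by group⟩
  · exact ⟨u (Multiplicative.ofAdd y), ⟨_, rfl⟩, rfl⟩
  · have e' : m⁻¹ * ((uval u y)⁻¹ * b) * m = b' := by
      rw [show b = uval u y * m * b' * m⁻¹ by rw [← e, mul_inv_cancel_right]]
      group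
    rw [e']
    exact hb'

/-- **`B = T · U_α`** (the content of Springer 7.2.3 (i) `dim U = 1`, for the reductive group of
semisimple rank one at hand): by `exists_eq_uval_mul`, `B ⊆ U_α · I` with `I = ⋂_{B' ⊇ T} B'`
(`= B ∩ m B m⁻¹` by `borel_eq_or`), whose identity component is `T`
(`identityComponent_iInf_borel_eq`, Milne 17.56); so `T · U_α` has finite index in `B`, and `B` is
connected. [cite: SpringerLAG1998, 7.2.3 (i); Milne2017, 17.56] -/
theorem borel_eq_sup [IsAlgClosed k] (hG : IsConnectedReductive G) :
    B = T ⊔ u.range.map G.subtype := by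
  classical
  set H : Subgroup (GL n k) := T ⊔ u.range.map G.subtype with hHdef
  have hHB : H ≤ B := sup_le h.torus_le h.range_le
  refine le_antisymm ?_ hHB
  have hHalg : IsAlgebraicSubgroup H :=
    (isZConnected_sup h.torus.1 (h.rootHom.isZConnected_map_range h.alg)).1
  -- `I = ⋂_{B' ⊇ T} B'`, `I° = T`
  set I : Subgroup (GL n k) := ⨅ B' : {B' : Subgroup (GL n k) // IsBorelIn B' G ∧ T ≤ B'},
    (B' : Subgroup (GL n k)) with hIdef
  have hI : identityComponent I = T := identityComponent_iInf_borel_eq hG h.maxTorus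
  have hIalg : IsAlgebraicSubgroup I := by
    rw [hIdef, iInf]
    exact isAlgebraicSubgroup_sInf (by rintro _ ⟨B', rfl⟩; exact B'.2.1.2.1.1)
  have hIB : I ≤ B := iInf_le_of_le ⟨B, h.borel, h.torus_le⟩ le_rfl
  have hTI : T ≤ I := le_iInf fun B' => B'.2.2
  have hmemI : ∀ {x : GL n k}, x ∈ B → m⁻¹ * x * m ∈ B → x ∈ I := by
    intro x hxB hx'
    refine Subgroup.mem_iInf.2 fun B' => ?_
    rcases h.borel_eq_or B'.2.1 B'.2.2 with e | e
    · rw [e]; exact hxB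
    · rw [e, mem_map_conj_iff]; exact hx'
  -- `T` has finite index in `I`
  haveI hfinT : (T.subgroupOf I).FiniteIndex := by
    have := finiteIndex_identityComponent hIalg
    rwa [hI] at this
  haveI : Finite (↥I ⧸ T.subgroupOf I) := Subgroup.finite_quotient_of_finiteIndex
  -- the map `I/T → B/H` is well defined and surjective
  let f : ↥I → ↥B ⧸ H.subgroupOf B := fun x => QuotientGroup.mk (Subgroup.inclusion hIB x)
  have hf : ∀ a b : ↥I, @Setoid.r _ (QuotientGroup.leftRel (T.subgroupOf I)) a b → f a = f b := by
    intro a b hab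
    rw [QuotientGroup.leftRel_apply, Subgroup.mem_subgroupOf] at hab
    refine QuotientGroup.eq.2 ?_
    rw [Subgroup.mem_subgroupOf]
    exact Subgroup.mem_sup_left hab
  let ψ : ↥I ⧸ T.subgroupOf I → ↥B ⧸ H.subgroupOf B := Quotient.lift f hf
  have hψ : Function.Surjective ψ := by
    intro q
    obtain ⟨b, rfl⟩ := QuotientGroup.mk_surjective q
    obtain ⟨y, x, hxB, hx', e⟩ := h.exists_eq_uval_mul (B.inv_mem b.2)
    have hxI : x ∈ I := hmemI hxB hx'
    refine ⟨QuotientGroup.mk (⟨x, hxI⟩⁻¹ : ↥I), ?_⟩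
    change f (⟨x, hxI⟩⁻¹ : ↥I) = QuotientGroup.mk b
    refine QuotientGroup.eq.2 ?_
    rw [Subgroup.mem_subgroupOf]
    have hval : (((Subgroup.inclusion hIB (⟨x, hxI⟩⁻¹ : ↥I))⁻¹ * b : ↥B) : GL n k) = x * b := by
      simp [Subgroup.coe_inclusion]
    rw [hval, show x = (uval u y)⁻¹ * (b : GL n k)⁻¹ by rw [e, inv_mul_cancel_left],
      inv_mul_cancel_right, ← uval_neg]
    exact Subgroup.mem_sup_right ⟨u (Multiplicative.ofAdd (-y)), ⟨_, rfl⟩, rfl⟩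
  haveI : Finite (↥B ⧸ H.subgroupOf B) := Finite.of_surjective ψ hψ
  haveI : (H.subgroupOf B).FiniteIndex := Subgroup.finiteIndex_of_finite_quotient
  exact h.borel.2.1.le_of_finiteIndex le_rfl hHalg inferInstance

end RankOneBorelData

end BorelEq

/-! ### Springer 7.3.3 (ii) -/

section RankOne

/-- The image of the opposite root homomorphism `x ↦ g u(x) g⁻¹` is the conjugate of the image.
[folklore] -/
theorem map_range_conj_comp {G : Subgroup (GL n k)} (u : Multiplicative k →* ↥G) (g : ↥G) :
    ((MulAut.conj g).toMonoidHom.comp u).range.map G.subtype =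
      (u.range.map G.subtype).map (MulAut.conj (g : GL n k) : GL n k →* GL n k) := by
  rw [MonoidHom.range_comp, Subgroup.map_map, Subgroup.map_map]
  congr 1

/-- **Springer 7.3.3 (ii) with 7.3.2 — discharge of the named fact
`exists_rootHom_sup_isBorelIn_of_central`.** For `G` connected reductive over an algebraically
closed field, a maximal torus `T` and a root `α` with `(Ker α)°` central (semisimple rank one), with
a root homomorphism `u = u_α`: `T · U_α` is a Borel subgroup (`RankOneBorelData.borel_eq_sup`
applied to a Borel subgroup `B ⊇ T · U_α`, 6.2.7 / `exists_isBorelIn_ge`), `x ↦ m⁻¹ u(x) m` is a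
root homomorphism for `-α` (`RankOneBorelData.isRootHom_weyl`) generating with `T` the Borel
subgroup `m⁻¹ (T · U_α) m`, distinct from `T · U_α` as `U_α ∩ m B m⁻¹ = {e}`. Springer: "*(ii) `T`
and `Im u_α` generate a Borel subgroup of `G`*" (for both roots `±α` of 7.3.2).
[cite: SpringerLAG1998, 7.3.3 (ii) with 7.3.2] -/
theorem exists_rootHom_sup_isBorelIn_of_central_holds :
    exists_rootHom_sup_isBorelIn_of_central (k := k) (n := n) := by
  intro _ G T hG hT α hα hcen
  classical
  have hTt : IsTorusSubgroup T := hT.2.1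
  haveI : IsMulCommutative ↥T := hTt.2.1
  obtain ⟨u, hu⟩ : ∃ u : Multiplicative k →* ↥G, IsRootHom G T hT.1 (α : ↥T →* kˣ) u := by
    obtain ⟨-, hTG, u, hu⟩ := hα
    exact ⟨u, hu⟩
  set U : Subgroup (GL n k) := u.range.map G.subtype with hUdef
  -- a Borel subgroup containing `T · U_α`
  have hHconn : IsZConnected (T ⊔ U) := isZConnected_sup hTt.1 (hu.isZConnected_map_range hG.1.1)
  have hUcomm : ∀ a ∈ U, ∀ b ∈ U, a * b = b * a := by
    rintro _ ⟨_, ⟨x, rfl⟩, rfl⟩ _ ⟨_, ⟨y, rfl⟩, rfl⟩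
    change ((u x : ↥G) : GL n k) * ((u y : ↥G) : GL n k) = ((u y : ↥G) : GL n k) * ((u x : ↥G) : GL n k)
    rw [← Subgroup.coe_mul, ← map_mul, mul_comm, map_mul, Subgroup.coe_mul]
  haveI : IsSolvable ↥U := isSolvable_of_comm fun a b => Subtype.ext (hUcomm a a.2 b b.2)
  have hHsolv : IsSolvable ↥(T ⊔ U) :=
    isSolvable_sup_of_isSolvable_of_le_normalizer inferInstance hu.le_normalizer_map_range
  obtain ⟨B, hB, hHB⟩ := exists_isBorelIn_ge (sup_le hT.1 (Subgroup.map_subtype_le _)) hHconn hHsolv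
  obtain ⟨m, N, ρ, v, h⟩ := exists_rankOneBorelData hG hT hα hcen hu hB (le_sup_left.trans hHB)
    (le_sup_right.trans hHB)
  have hBeq : B = T ⊔ U := h.borel_eq_sup hG
  set u₂ : Multiplicative k →* ↥G := (MulAut.conj (⟨m, h.memG⟩⁻¹ : ↥G)).toMonoidHom.comp u with hu₂
  have hU₂ : T ⊔ u₂.range.map G.subtype = B.map (MulAut.conj m⁻¹ : GL n k →* GL n k) := by
    rw [hBeq, Subgroup.map_sup,
      Subgroup.mem_normalizer_iff_map_conj_eq.1 (Subgroup.inv_mem _ h.memN), hu₂,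
      map_range_conj_comp]
    rfl
  refine ⟨α, u, u₂, hu, h.isRootHom_weyl, hBeq ▸ hB, ?_, ?_⟩
  · rw [hU₂]
    exact hB.map_conj (G.inv_mem h.memG)
  · intro heq
    have hmem : uval u₂ 1 ∈ T ⊔ U := by
      rw [heq]
      exact uval_mem_sup u₂ 1
    rw [hu₂, h.uval_weyl, ← hBeq] at hmem
    exact one_ne_zero (h.inter 1 hmem)

end RankOne

end Literature.NumberTheory.Automorphic
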